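import Literature.NumberTheory.Rogawski1990.SingularObsHasseArchSignature
import Literature.NumberTheory.NumberFields.CMFieldPrescribedSigns
import HarnessLib

/-!
# Local realisation at infinity, part A: the archimedean data of a conjugator of a split-semisimple element
# (Rogawski 1990, §3.3 Prop. 3.3.1 p. 22, §3.8 Prop. 3.8.1 (d) p. 30)

Topic `NumberTheory/Rogawski1990`; namespace `Literature.NumberTheory.Rogawski1990`; **THEOREMS ONLY** (no definition, no named fact, no instance, no
notation, no `sorry`).  Cell `pub/hodgecm-mathlib`, ENGINE T1 (crux H413 = `stmt-HodgeConjecture-24833`), row O7 «singular semisimple classes», piece **(LR-∞)**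
(O7 OWNER WORD #22): the INPUT half — what an archimedean conjugator `g` of `γ ⊗ 1` into `U(H)(L ⊗ ℝ)` hands to the prescribed-signature realisation ★ (R6a-s′).
Consumed by part B `SingularArchRealisation` (the theorem `hLR∞` of the ED 1.24 anchor).  HC_CM is proved only modulo the printed citations until rung 0 closes.

THE MATHEMATICS.  For `g ∈ GL₃(L⊗ℝ)` with `g(γ⊗1)g⁻¹ ∈ U(H)(L⊗ℝ)` the form `H_{g,∞}` is `γ⊗1`-invariant (★ `commute_inv_mul_twistGram`), hence framed by
`P⊗1` as `(H_a⊗1)y₁ ⊕ᶠ (H_b⊗1)y₂` (★ `exists_twistGram_frame_eq_finSum`); `p(w)` := positive index of the plane block at `w`, and `ξ ∈ L⁺ˣ` carries the signs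
`sign((H_b⊗1)y₂)_w · sign w((H_b)₀₀)` (★ `NumberFields.exists_isReal_signs`).  ONE identity `det((H_a⊗1)y₁) det((H_b⊗1)y₂) = σ_∞(det g) det g (det H_a⊗1)((H_b)₀₀⊗1)`
(★ `det_inv_mul_twistGram`), read at `w` in real numbers, gives PARITY and TOTAL (★ `re_det_pos_iff_even_card_neg_eigenvalues`, ★ `card_eigenvalues_finSum_eq_add`,
★ `card_pos_eigenvalues_fin_one`, Sylvester ★ `Landherr.card_pos_eigenvalues_eq_of_congr`).

* §1 private real/complex sign plumbing.
* §2 **`exists_archSignatureData_of_conj_mem_arch`** `(hH hHd) (hab) (γ) (hP hγP) (hHa hHb hda hdb) (g) (hg : g (γ⊗1) g⁻¹ ∈ U(H)(L⊗ℝ)) : ∃ p ξ, σξ = ξ ∧ ξ ≠ 0 ∧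
  (∀ w, p w ≤ 2) ∧ hsign ∧ htot ∧ ∃ y₁ y₂, ‹frame of H_{g,∞}› ∧ ‹#pos plane block = p› ∧ ‹#pos line block = [0 < Re w(ξ⁻¹(H_b)₀₀)]›` — `(p, hp, hsign, htot)` in the
  letters of ★ `exists_commute_hermStar_eq_of_frame_of_signature_clause5` at `ξ`.

## References
* [Rogawski1990] J. D. Rogawski, *Automorphic Representations of Unitary Groups in Three Variables*, Ann. of Math. Stud. 123 (1990), §3.3 Prop. 3.3.1 p. 22,
  §3.8 Prop. 3.8.1 (d) p. 30, §14.1 p. 232.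
* [Landherr1936HermitianForms] W. Landherr, Abh. Math. Sem. Hamburg 11 (1936) 245–248.
-/

set_option autoImplicit false

noncomputable section

open NumberField NumberField.InfinitePlace
open scoped Matrix MatrixGroups ComplexConjugate ComplexOrder

namespace Literature.NumberTheory.Rogawski1990

open Literature.NumberTheory.Automorphic Literature.NumberTheory.Automorphic.UnitaryGroup
open Literature.AlgebraicGeometry.ShimuraVarieties (unitaryGroup mem_unitaryGroup_iff)

/-! ## §1 Sign bookkeeping over `ℝ` and `ℂ` -/

section Signs

/-- For nonzero reals: `0 < A ↔ (0 < A·B ↔ 0 < B)`. [folklore] -/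
private theorem pos_iff_mul_pos_iff {A B : ℝ} (hA : A ≠ 0) (hB : B ≠ 0) : 0 < A ↔ (0 < A * B ↔ 0 < B) := by
  rcases lt_or_gt_of_ne hA with hA | hA <;> rcases lt_or_gt_of_ne hB with hB | hB
  · exact ⟨fun h => absurd hA (not_lt.2 h.le), fun h => absurd hB (not_lt.2 (h.1 (mul_pos_of_neg_of_neg hA hB)).le)⟩
  · exact ⟨fun h => absurd hA (not_lt.2 h.le), fun h => absurd (h.2 hB) (not_lt.2 (mul_neg_of_neg_of_pos hA hB).le)⟩
  · exact ⟨fun _ => ⟨fun h => absurd h (not_lt.2 (mul_neg_of_pos_of_neg hA hB).le), fun h => absurd hB (not_lt.2 h.le)⟩, fun _ => hA⟩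
  · exact ⟨fun _ => ⟨fun _ => hB, fun _ => mul_pos hA hB⟩, fun _ => hA⟩

/-- For nonzero reals: `0 < d·e ↔ (0 < d ↔ 0 < e)`. [folklore] -/
private theorem mul_pos_iff_pos_iff_pos {d e : ℝ} (hd : d ≠ 0) (he : e ≠ 0) : 0 < d * e ↔ (0 < d ↔ 0 < e) := by
  have := pos_iff_mul_pos_iff hd he
  tauto

/-- Propositional shuffle used for the parity condition. [folklore] -/
private theorem iff_iff_iff_shuffle (X Y Z : Prop) : (((X ↔ Y) ↔ Z) ↔ ((Z ↔ Y) ↔ X)) := by tauto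

/-- Propositional absorption used for the line block. [folklore] -/
private theorem iff_iff_iff_self (X Y : Prop) : (X ↔ ((X ↔ Y) ↔ Y)) := by tauto

/-- A complex number with zero imaginary part is its real part. [folklore] -/
private theorem eq_coe_re_of_im_eq_zero {z : ℂ} (h : z.im = 0) : z = (z.re : ℂ) := Complex.ext (by simp) (by simp [h])

/-- The determinant of a complex hermitian matrix is real. [folklore] -/
private theorem det_im_eq_zero_of_isHermitian {n : Type} [Fintype n] [DecidableEq n] {A : Matrix n n ℂ} (hA : A.IsHermitian) : A.det.im = 0 := by
  rw [hA.det_eq_prod_eigenvalues]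
  have : (∏ i, (RCLike.ofReal (hA.eigenvalues i) : ℂ)) = ((∏ i, hA.eigenvalues i : ℝ) : ℂ) := by rw [Complex.ofReal_prod]; rfl
  rw [this, Complex.ofReal_im]

end Signs

/-! ## §2 The archimedean data of a conjugator, and realisation at `∞` of every form with those data -/

section ArchData

variable {L : Type} [Field L] [NumberField L] [IsCMField L] {H : Matrix (Fin 3) (Fin 3) L}

/-- `⊕ᶠ` is injective in the pair of blocks. [folklore] -/
private theorem finSum_injective_pair₃ {S : Type*} [CommRing S] {N₁ N₂ : ℕ} {A C : Matrix (Fin N₁) (Fin N₁) S} {B D : Matrix (Fin N₂) (Fin N₂) S}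
    (h : finSum N₁ N₂ A B = finSum N₁ N₂ C D) : A = C ∧ B = D := by
  have h' := (Matrix.reindex finSumFinEquiv finSumFinEquiv).injective h
  rw [Matrix.fromBlocks_inj] at h'
  exact ⟨h'.1, h'.2.2.2⟩

/-- `det (A ⊕ᶠ B) = det A · det B`. [folklore] -/
private theorem det_finSum₃' {S : Type*} [CommRing S] {N₁ N₂ : ℕ} (A : Matrix (Fin N₁) (Fin N₁) S) (B : Matrix (Fin N₂) (Fin N₂) S) :
    (finSum N₁ N₂ A B).det = A.det * B.det := by
  rw [finSum, Matrix.det_reindex_self, Matrix.det_fromBlocks_zero₂₁]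

/-- `(A ⊕ᶠ B)(C ⊕ᶠ D) = AC ⊕ᶠ BD`. [folklore] -/
private theorem finSum_mul_finSum₃' {S : Type*} [CommRing S] {N₁ N₂ : ℕ} (A C : Matrix (Fin N₁) (Fin N₁) S) (B D : Matrix (Fin N₂) (Fin N₂) S) :
    finSum N₁ N₂ A B * finSum N₁ N₂ C D = finSum N₁ N₂ (A * C) (B * D) := by
  simp only [finSum, Matrix.reindex_apply, Matrix.submatrix_mul_equiv, Matrix.fromBlocks_multiply, Matrix.mul_zero, Matrix.zero_mul,
    add_zero, zero_add]

/-- Positive-index counts of equal hermitian matrices agree (transport along `X = A`). [folklore] -/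
private theorem card_pos_eigenvalues_congr₃ {n : Type} [Fintype n] [DecidableEq n] {X A : Matrix n n ℂ} (h : X = A) (hX : X.IsHermitian)
    (hA : A.IsHermitian) :
    (Finset.univ.filter fun i => 0 < hX.eigenvalues i).card = (Finset.univ.filter fun i => 0 < hA.eigenvalues i).card := by
  subst h
  rfl

omit [NumberField L] [IsCMField L] in
/-- Signatures do not see complex conjugation of the embedding: `#pos τ̄(M) = #pos τ(M)`. [cite: Landherr1936HermitianForms] -/
private theorem card_pos_eigenvalues_map_conjugate₃ {n : Type} [Fintype n] [DecidableEq n] {M : Matrix n n L} {τ : L →+* ℂ}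
    (h₁ : (M.map τ).IsHermitian) (h₂ : (M.map (ComplexEmbedding.conjugate τ)).IsHermitian) :
    (Finset.univ.filter fun i => 0 < h₂.eigenvalues i).card = (Finset.univ.filter fun i => 0 < h₁.eigenvalues i).card := by
  have hMT : M.map (ComplexEmbedding.conjugate τ) = (M.map τ)ᵀ := by
    have e : M.map (ComplexEmbedding.conjugate τ) = (M.map τ).map (starRingEnd ℂ) := by
      rw [Matrix.map_map]; rfl
    rw [e]
    have hc : ((M.map τ).map (starRingEnd ℂ))ᵀ = M.map τ := h₁.eq
    have := congrArg Matrix.transpose hc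
    rwa [Matrix.transpose_transpose] at this
  have hT : ((M.map τ)ᵀ).IsHermitian := hMT ▸ h₂
  have key : ∀ {B : Matrix n n ℂ} (hB : B.IsHermitian),
      (Finset.univ.filter fun i => 0 < hB.eigenvalues i).card = B.charpoly.roots.countP (fun z => 0 < RCLike.re z) := by
    intro B hB
    rw [hB.roots_charpoly_eq_eigenvalues, Multiset.countP_map, Finset.card_def, Finset.filter_val]
    congr 1
  rw [card_pos_eigenvalues_congr₃ hMT h₂ hT, key hT, key h₁, Matrix.charpoly_transpose]

/-- A `σ`-fixed element of the CM field `L` is real at every complex embedding. [folklore] -/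
private theorem im_embedding_eq_zero_of_complexConj_eq {a : L} (ha : IsCMField.complexConj L a = a) (τ : L →+* ℂ) : (τ a).im = 0 := by
  rw [← Complex.conj_eq_iff_im, ← IsCMField.complexEmbedding_complexConj, ha]

/-- **THE ARCHIMEDEAN DATA OF A CONJUGATOR.**  `H` hermitian non-degenerate over the CM field `L`, plane-first singular frame `P` of `γ ∈ U(H)(L⁺)`
(`ᵗ(σP) H P = H_a ⊕ᶠ H_b`, `γ P = P (a·1₂ ⊕ᶠ b·1₁)`, `a ≠ b`), `g ∈ GL₃(L ⊗ ℝ)` with `g (γ⊗1) g⁻¹ ∈ U(H)(L ⊗ ℝ)`.  Then `H_{g,∞}` is framed by `P ⊗ 1` as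
`(H_a⊗1)y₁ ⊕ᶠ (H_b⊗1)y₂`, and with `p(w) :=` the positive index of the plane block at `w` there is `ξ ∈ L⁺ˣ` with (i) `p ≤ 2`, (ii) PARITY
`0 < Re τ(ξ det H_a) ↔ 2 − p(w_τ)` even, (iii) TOTAL `#pos τ(H) = p(w_τ) + [0 < Re τ(ξ⁻¹ (H_b)₀₀)]` — the inputs `(p, hp, hsign, htot)` of ★ (R6a-s′)
`exists_commute_hermStar_eq_of_frame_of_signature_clause5` — and (iv) the line block of `H_{g,∞}` has positive index `[0 < Re w(ξ⁻¹ (H_b)₀₀)]`.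
[cite: Rogawski1990, §3.8 Prop. 3.8.1 (d) p. 30; §3.3 Prop. 3.3.1 p. 22] [cite: Landherr1936HermitianForms] -/
theorem exists_archSignatureData_of_conj_mem_arch (hH : (H.map (cmConjRingHom L))ᵀ = H) (hHd : H.det ≠ 0) {a b : L} (hab : a ≠ b)
    (γ : unitaryGroup (cmConjRingHom L) H) {P : GL (Fin 3) L} {Ha : Matrix (Fin 2) (Fin 2) L} {Hb : Matrix (Fin 1) (Fin 1) L}
    (hP : (((P : Matrix (Fin 3) (Fin 3) L)).map (cmConjRingHom L))ᵀ * H * (P : Matrix (Fin 3) (Fin 3) L) = finSum 2 1 Ha Hb)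
    (hγP : ((γ : GL (Fin 3) L) : Matrix (Fin 3) (Fin 3) L) * (P : Matrix (Fin 3) (Fin 3) L) =
      (P : Matrix (Fin 3) (Fin 3) L) * finSum 2 1 (a • (1 : Matrix (Fin 2) (Fin 2) L)) (b • (1 : Matrix (Fin 1) (Fin 1) L)))
    (hHa : (Ha.map (cmConjRingHom L))ᵀ = Ha) (hHb : (Hb.map (cmConjRingHom L))ᵀ = Hb) (hda : Ha.det ≠ 0) (hdb : Hb.det ≠ 0)
    (g : GL (Fin 3) (mixedEmbedding.mixedSpace L))
    (hg : g * Matrix.GeneralLinearGroup.map (NumberField.mixedEmbedding L) (γ : GL (Fin 3) L) * g⁻¹ ∈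
      UnitaryGroup.arch (↥(maximalRealSubfield L)) L (IsCMField.complexConj L) 3 H) :
    ∃ (p : InfinitePlace L → ℕ) (ξ : L), cmConjRingHom L ξ = ξ ∧ ξ ≠ 0 ∧ (∀ w, p w ≤ 2) ∧
      (∀ τ : L →+* ℂ, 0 < (τ (ξ * Ha.det)).re ↔ Even (2 - p (InfinitePlace.mk τ))) ∧
      (∀ (τ : L →+* ℂ) (h₁ : (H.map τ).IsHermitian),
        (Finset.univ.filter fun i => 0 < h₁.eigenvalues i).card = p (InfinitePlace.mk τ) + (if 0 < (τ (ξ⁻¹ * Hb 0 0)).re then 1 else 0)) ∧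
      ∃ (y₁ : Matrix (Fin 2) (Fin 2) (mixedEmbedding.mixedSpace L)) (y₂ : Matrix (Fin 1) (Fin 1) (mixedEmbedding.mixedSpace L)),
        twistGram (UnitaryGroup.conjMixed (↥(maximalRealSubfield L)) L (IsCMField.complexConj L))
            (twistGram (UnitaryGroup.conjMixed (↥(maximalRealSubfield L)) L (IsCMField.complexConj L)) (H.map (NumberField.mixedEmbedding L))
              (g : Matrix (Fin 3) (Fin 3) (mixedEmbedding.mixedSpace L)))
            ((P : Matrix (Fin 3) (Fin 3) L).map (NumberField.mixedEmbedding L)) =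
          finSum 2 1 (Ha.map (NumberField.mixedEmbedding L) * y₁) (Hb.map (NumberField.mixedEmbedding L) * y₂) ∧
        (∀ (w : {w : InfinitePlace L // w.IsComplex}) (h : ((Ha.map (NumberField.mixedEmbedding L) * y₁).map (UnitaryGroup.evalC L w)).IsHermitian),
          (Finset.univ.filter fun i => 0 < h.eigenvalues i).card = p w.1) ∧
        (∀ (w : {w : InfinitePlace L // w.IsComplex}) (h : ((Hb.map (NumberField.mixedEmbedding L) * y₂).map (UnitaryGroup.evalC L w)).IsHermitian),
          (Finset.univ.filter fun i => 0 < h.eigenvalues i).card = if 0 < (w.1.embedding (ξ⁻¹ * Hb 0 0)).re then 1 else 0) := by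
  set σv := UnitaryGroup.conjMixed (↥(maximalRealSubfield L)) L (IsCMField.complexConj L) with hσv
  set F : L →+* mixedEmbedding.mixedSpace L := NumberField.mixedEmbedding L with hFdef
  have hc1 : IsCMField.complexConj L ≠ 1 := IsCMField.complexConj_ne_one L
  have hfix : ∀ w : InfinitePlace L, IsCMField.complexConj L • w = w := UnitaryGroup.complexConj_smul_infinitePlace L
  have hσσv : ∀ z, σv (σv z) = z := conjMixed_conjMixed_apply _ L _ hc1 hfix
  have hF : ∀ r : L, F ((cmConjRingHom L) r) = σv (F r) := fun r => by
    rw [hFdef, hσv, UnitaryGroup.conjMixed_mixedEmbedding]; rfl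
  have hFw : ∀ (w : {w : InfinitePlace L // w.IsComplex}) (r : L), UnitaryGroup.evalC L w (F r) = w.1.embedding r := fun w r => by
    rw [hFdef, UnitaryGroup.evalC_apply, NumberField.mixedEmbedding.mixedEmbedding_apply_isComplex]
  have hFmw : ∀ (w : {w : InfinitePlace L // w.IsComplex}) {m k : ℕ} (M : Matrix (Fin m) (Fin k) L),
      (M.map F).map (UnitaryGroup.evalC L w) = M.map w.1.embedding := by
    intro w m k M; rw [Matrix.map_map]; exact Matrix.ext fun i j => hFw w (M i j)
  have hallc : ∀ w : InfinitePlace L, w.IsComplex := fun w => UnitaryGroup.isComplex_of_smul_eq _ L _ hc1 (hfix w)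
  have harchF : archFormOf L 3 H = H.map F := by rw [hFdef]; rfl
  clear_value F
  set Hv : Matrix (Fin 3) (Fin 3) (mixedEmbedding.mixedSpace L) := H.map F with hHv
  set Pv : GL (Fin 3) (mixedEmbedding.mixedSpace L) := Matrix.GeneralLinearGroup.map F P with hPvdef
  have hPv : Pv.val = (P : Matrix (Fin 3) (Fin 3) L).map F := rfl
  set γm : Matrix (Fin 3) (Fin 3) L := ((γ : GL (Fin 3) L) : Matrix (Fin 3) (Fin 3) L) with hγm
  set γv : Matrix (Fin 3) (Fin 3) (mixedEmbedding.mixedSpace L) := γm.map F with hγvdef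
  have hγv : ((Matrix.GeneralLinearGroup.map F (γ : GL (Fin 3) L) : GL (Fin 3) (mixedEmbedding.mixedSpace L)) :
      Matrix (Fin 3) (Fin 3) (mixedEmbedding.mixedSpace L)) = γv := rfl
  set G' : Matrix (Fin 3) (Fin 3) (mixedEmbedding.mixedSpace L) := twistGram σv Hv (g : Matrix (Fin 3) (Fin 3) (mixedEmbedding.mixedSpace L)) with hG'def
  have hHu : IsUnit H.det := isUnit_iff_ne_zero.mpr hHd
  have hHvd : IsUnit Hv.det := by rw [hHv, ← RingHom.mapMatrix_apply, ← RingHom.map_det]; exact hHu.map F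
  have hFab : IsUnit (F a - F b) := by rw [← map_sub]; exact (IsUnit.mk0 _ (sub_ne_zero.mpr hab)).map F
  have hσF : (⇑σv ∘ ⇑F : L → mixedEmbedding.mixedSpace L) = ⇑F ∘ ⇑(cmConjRingHom L) := funext fun r => (hF r).symm
  have hσvHv : (Hv.map σv)ᵀ = Hv := by rw [hHv, Matrix.map_map, hσF, ← Matrix.map_map, ← Matrix.transpose_map, hH]
  have hG' : (G'.map σv)ᵀ = G' := conjTranspose_twistGram σv Hv hσσv hσvHv _
  have hgd : IsUnit (g : Matrix (Fin 3) (Fin 3) (mixedEmbedding.mixedSpace L)).det := Matrix.isUnits_det_units g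
  have hG'd : IsUnit G'.det := by rw [hG'def, det_twistGram]; exact ((hgd.map σv).mul hHvd).mul hgd
  have hPv_frame : twistGram σv Hv Pv.val = finSum 2 1 (Ha.map F) (Hb.map F) := by
    rw [hHv, hPv, ← twistGram_map (cmConjRingHom L) H σv F hF, twistGram_def, hP, finSum_map]
  have hsmul1 : ∀ (n : ℕ) (c : L), (c • (1 : Matrix (Fin n) (Fin n) L)).map F = F c • (1 : Matrix (Fin n) (Fin n) (mixedEmbedding.mixedSpace L)) :=
    fun n c => by rw [Matrix.map_smul' _ _ _ (map_mul F), Matrix.map_one _ (map_zero F) (map_one F)]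
  have hγv_frame : γv * Pv.val =
      Pv.val * finSum 2 1 (F a • (1 : Matrix (Fin 2) (Fin 2) (mixedEmbedding.mixedSpace L))) (F b • (1 : Matrix (Fin 1) (Fin 1) (mixedEmbedding.mixedSpace L))) := by
    rw [hγvdef, hγm, hPv, ← Matrix.map_mul, hγP, Matrix.map_mul, finSum_map, hsmul1, hsmul1]
  have hγvU : Matrix.GeneralLinearGroup.map F (γ : GL (Fin 3) L) ∈ unitaryGroup σv Hv := by
    rw [mem_unitaryGroup_iff, hγv, hγvdef, hγm, hHv, ← twistGram_def, ← twistGram_map (cmConjRingHom L) H σv F hF,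
      (twistGram_coe_eq_iff_mem_unitaryGroup (cmConjRingHom L) H _).mpr γ.2]
  have hxU : g * Matrix.GeneralLinearGroup.map F (γ : GL (Fin 3) L) * g⁻¹ ∈ unitaryGroup σv Hv := by
    rw [mem_unitaryGroup_iff, ← twistGram_def, ← harchF]
    exact (UnitaryGroup.mem_arch_iff _ L _ 3 H _).mp hg
  have hxv_comm : Hv⁻¹ * G' * γv = γv * (Hv⁻¹ * G') :=
    (commute_inv_mul_twistGram σv Hv hHvd (γ := ⟨_, hγvU⟩) (δ := ⟨_, hxU⟩) rfl).eq
  obtain ⟨y₁, y₂, hG'P⟩ := exists_twistGram_frame_eq_finSum (N₁ := 2) (N₂ := 1) σv hHvd hFab hPv_frame hγv_frame hxv_comm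
  change Matrix (Fin 2) (Fin 2) (mixedEmbedding.mixedSpace L) at y₁
  change twistGram σv G' Pv.val = finSum 2 1 (Ha.map F * y₁) (Hb.map F * y₂) at hG'P
  have hPG' : ((twistGram σv G' Pv.val).map σv)ᵀ = twistGram σv G' Pv.val := conjTranspose_twistGram σv G' hσσv hG' _
  rw [hG'P, transpose_finSum_map] at hPG'
  obtain ⟨hb₁, hb₂⟩ := finSum_injective_pair₃ hPG'
  have herm : ∀ {m : ℕ} {X : Matrix (Fin m) (Fin m) (mixedEmbedding.mixedSpace L)}, (X.map σv)ᵀ = X →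
      ∀ w : {w : InfinitePlace L // w.IsComplex}, (X.map (UnitaryGroup.evalC L w)).IsHermitian :=
    fun hX w => isHermitian_map_evalC_of_transpose_map_conjMixed _ L _ hc1 hfix hX w
  have hPu : IsUnit Pv.val.det := by
    rw [hPv, ← RingHom.mapMatrix_apply, ← RingHom.map_det]; exact (Matrix.isUnits_det_units P).map F
  have hxvP : Hv⁻¹ * G' * Pv.val = Pv.val * finSum 2 1 y₁ y₂ := by
    have hfu : IsUnit (finSum 2 1 (Ha.map F) (Hb.map F)).det := by
      rw [← hPv_frame, det_twistGram]; exact ((hPu.map σv).mul hHvd).mul hPu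
    have h1 : finSum 2 1 (Ha.map F) (Hb.map F) * (Pv.val⁻¹ * (Hv⁻¹ * G') * Pv.val) = finSum 2 1 (Ha.map F) (Hb.map F) * finSum 2 1 y₁ y₂ := by
      rw [finSum_mul_finSum₃', ← hG'P, ← hPv_frame, twistGram_def, twistGram_def]
      simp only [Matrix.mul_assoc]
      rw [Matrix.mul_nonsing_inv_cancel_left _ _ hPu, Matrix.mul_nonsing_inv_cancel_left _ _ hHvd]
    have h2 : Pv.val⁻¹ * (Hv⁻¹ * G') * Pv.val = finSum 2 1 y₁ y₂ := by
      have h := congrArg (fun M => (finSum 2 1 (Ha.map F) (Hb.map F))⁻¹ * M) h1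
      simpa only [← Matrix.mul_assoc, Matrix.nonsing_inv_mul _ hfu, Matrix.one_mul] using h
    rw [← h2, ← Matrix.mul_assoc, ← Matrix.mul_assoc, Matrix.mul_nonsing_inv _ hPu, Matrix.one_mul]
  have hdet12 : y₁.det * y₂.det = σv (g : Matrix (Fin 3) (Fin 3) (mixedEmbedding.mixedSpace L)).det * (g : Matrix (Fin 3) (Fin 3) (mixedEmbedding.mixedSpace L)).det := by
    have hfin : finSum 2 1 y₁ y₂ = Pv.val⁻¹ * (Hv⁻¹ * G') * Pv.val := by
      rw [Matrix.mul_assoc, hxvP, ← Matrix.mul_assoc, Matrix.nonsing_inv_mul _ hPu, Matrix.one_mul]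
    have h := congrArg Matrix.det hfin
    rw [det_finSum₃', Matrix.det_conj' Pv.isUnit, hG'def, det_inv_mul_twistGram σv Hv hHvd] at h
    exact h
  have hDET : (Ha.map F * y₁).det * (Hb.map F * y₂).det =
      F Ha.det * F Hb.det * (σv (g : Matrix (Fin 3) (Fin 3) (mixedEmbedding.mixedSpace L)).det * (g : Matrix (Fin 3) (Fin 3) (mixedEmbedding.mixedSpace L)).det) := by
    rw [Matrix.det_mul, Matrix.det_mul, ← RingHom.mapMatrix_apply F Ha, ← RingHom.map_det, ← RingHom.mapMatrix_apply F Hb, ← RingHom.map_det, ← hdet12]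
    ring
  have hdaσ : IsCMField.complexConj L Ha.det = Ha.det := by
    have h := congrArg Matrix.det hHa
    rw [Matrix.det_transpose, ← RingHom.mapMatrix_apply, ← RingHom.map_det] at h
    exact h
  have hb00σ : IsCMField.complexConj L (Hb 0 0) = Hb 0 0 := by
    have h := congrFun (congrFun hHb 0) 0
    rwa [Matrix.transpose_apply, Matrix.map_apply] at h
  have hb00 : Hb 0 0 ≠ 0 := by rwa [Matrix.det_fin_one] at hdb
  have hAu : IsUnit (Ha.map F * y₁).det ∧ IsUnit (Hb.map F * y₂).det := by
    have hprod : IsUnit ((Ha.map F * y₁).det * (Hb.map F * y₂).det) := by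
      rw [hDET]
      exact ((((IsUnit.mk0 _ hda).map F).mul ((IsUnit.mk0 _ hdb).map F)).mul ((hgd.map σv).mul hgd))
    exact ⟨isUnit_of_mul_isUnit_left hprod, isUnit_of_mul_isUnit_right hprod⟩
  have hAre : ∀ w : {w : InfinitePlace L // w.IsComplex}, ((Ha.map F * y₁).map (UnitaryGroup.evalC L w)).det =
      ((((Ha.map F * y₁).map (UnitaryGroup.evalC L w)).det.re : ℝ) : ℂ) :=
    fun w => eq_coe_re_of_im_eq_zero (det_im_eq_zero_of_isHermitian (herm hb₁ w))
  have hBre : ∀ w : {w : InfinitePlace L // w.IsComplex}, ((Hb.map F * y₂).map (UnitaryGroup.evalC L w)).det =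
      ((((Hb.map F * y₂).map (UnitaryGroup.evalC L w)).det.re : ℝ) : ℂ) :=
    fun w => eq_coe_re_of_im_eq_zero (det_im_eq_zero_of_isHermitian (herm hb₂ w))
  have hdre : ∀ w : {w : InfinitePlace L // w.IsComplex}, w.1.embedding Ha.det = (((w.1.embedding Ha.det).re : ℝ) : ℂ) :=
    fun w => eq_coe_re_of_im_eq_zero (im_embedding_eq_zero_of_complexConj_eq hdaσ _)
  have here_ : ∀ w : {w : InfinitePlace L // w.IsComplex}, w.1.embedding (Hb 0 0) = (((w.1.embedding (Hb 0 0)).re : ℝ) : ℂ) :=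
    fun w => eq_coe_re_of_im_eq_zero (im_embedding_eq_zero_of_complexConj_eq hb00σ _)
  have hA0 : ∀ w : {w : InfinitePlace L // w.IsComplex}, ((Ha.map F * y₁).map (UnitaryGroup.evalC L w)).det.re ≠ 0 := fun w h0 => by
    have h := (hAu.1.map (UnitaryGroup.evalC L w)).ne_zero
    rw [RingHom.map_det, RingHom.mapMatrix_apply, hAre w, h0, Complex.ofReal_zero] at h
    exact h rfl
  have hB0 : ∀ w : {w : InfinitePlace L // w.IsComplex}, ((Hb.map F * y₂).map (UnitaryGroup.evalC L w)).det.re ≠ 0 := fun w h0 => by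
    have h := (hAu.2.map (UnitaryGroup.evalC L w)).ne_zero
    rw [RingHom.map_det, RingHom.mapMatrix_apply, hBre w, h0, Complex.ofReal_zero] at h
    exact h rfl
  have hd0 : ∀ w : {w : InfinitePlace L // w.IsComplex}, (w.1.embedding Ha.det).re ≠ 0 :=
    fun w => QuadraticForms.Landherr.re_ne_zero_of_isReal hdaσ hda _
  have he0 : ∀ w : {w : InfinitePlace L // w.IsComplex}, (w.1.embedding (Hb 0 0)).re ≠ 0 :=
    fun w => QuadraticForms.Landherr.re_ne_zero_of_isReal hb00σ hb00 _
  have hABde : ∀ w : {w : InfinitePlace L // w.IsComplex},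
      ((Ha.map F * y₁).map (UnitaryGroup.evalC L w)).det.re * ((Hb.map F * y₂).map (UnitaryGroup.evalC L w)).det.re =
        (w.1.embedding Ha.det).re * (w.1.embedding (Hb 0 0)).re *
          Complex.normSq (UnitaryGroup.evalC L w (g : Matrix (Fin 3) (Fin 3) (mixedEmbedding.mixedSpace L)).det) := by
    intro w
    have h := congrArg (UnitaryGroup.evalC L w) hDET
    have eA : UnitaryGroup.evalC L w (Ha.map F * y₁).det = ((Ha.map F * y₁).map (UnitaryGroup.evalC L w)).det := by
      rw [RingHom.map_det, RingHom.mapMatrix_apply]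
    have eB : UnitaryGroup.evalC L w (Hb.map F * y₂).det = ((Hb.map F * y₂).map (UnitaryGroup.evalC L w)).det := by
      rw [RingHom.map_det, RingHom.mapMatrix_apply]
    simp only [map_mul] at h
    rw [eA, eB, hFw, hFw, UnitaryGroup.evalC_conjMixed _ L _ (hfix w.1) hc1, Matrix.det_fin_one Hb, hAre w, hBre w, hdre w, here_ w,
      ← Complex.normSq_eq_conj_mul_self] at h
    exact_mod_cast h
  obtain ⟨ξ, hξσ, hξ⟩ := NumberFields.exists_isReal_signs L fun w =>
    decide ((0 < ((Hb.map F * y₂).map (UnitaryGroup.evalC L ⟨w, hallc w⟩)).det.re) ↔ (0 < ((⟨w, hallc w⟩ : {w : InfinitePlace L // w.IsComplex}).1.embedding (Hb 0 0)).re))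
  have hξ0 : ξ ≠ 0 := by
    intro h0
    obtain ⟨r, hr, hr0, -⟩ := hξ (InfinitePlace.embedding (Classical.arbitrary (InfinitePlace L)))
    rw [h0, map_zero] at hr
    exact hr0 (by exact_mod_cast hr.symm)
  have hre : ∀ (τ : L →+* ℂ) (x : L), (τ x).re = ((InfinitePlace.mk τ).embedding x).re := fun τ x => by
    rcases InfinitePlace.embedding_mk_eq τ with h | h
    · rw [h]
    · rw [h, ComplexEmbedding.conjugate_coe_eq, Complex.conj_re]
  have hξw : ∀ w : {w : InfinitePlace L // w.IsComplex}, ∃ r : ℝ, w.1.embedding ξ = r ∧ r ≠ 0 ∧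
      (0 < r ↔ ((0 < ((Hb.map F * y₂).map (UnitaryGroup.evalC L w)).det.re) ↔ (0 < (w.1.embedding (Hb 0 0)).re))) := by
    intro w
    obtain ⟨r, hr, hr0, hiff⟩ := hξ w.1.embedding
    rw [InfinitePlace.mk_embedding, decide_eq_true_iff] at hiff
    exact ⟨r, hr, hr0, hiff⟩
  have hline : ∀ w : {w : InfinitePlace L // w.IsComplex},
      (0 < ((Hb.map F * y₂).map (UnitaryGroup.evalC L w)).det.re) ↔ (0 < (w.1.embedding (ξ⁻¹ * Hb 0 0)).re) := by
    intro w
    obtain ⟨r, hr, hr0, hiff⟩ := hξw w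
    have e1 : (w.1.embedding (ξ⁻¹ * Hb 0 0)).re = r⁻¹ * (w.1.embedding (Hb 0 0)).re := by
      rw [map_mul, map_inv₀, hr, here_ w, ← Complex.ofReal_inv, ← Complex.ofReal_mul, Complex.ofReal_re, Complex.ofReal_re]
    rw [e1, mul_pos_iff_pos_iff_pos (inv_ne_zero hr0) (he0 w), inv_pos, hiff]
    exact iff_iff_iff_self _ _
  have hN : ∀ w : {w : InfinitePlace L // w.IsComplex},
      0 < Complex.normSq (UnitaryGroup.evalC L w (g : Matrix (Fin 3) (Fin 3) (mixedEmbedding.mixedSpace L)).det) :=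
    fun w => Complex.normSq_pos.mpr (hgd.map (UnitaryGroup.evalC L w)).ne_zero
  have hplane : ∀ w : {w : InfinitePlace L // w.IsComplex},
      (0 < ((Ha.map F * y₁).map (UnitaryGroup.evalC L w)).det.re) ↔
        (((0 < (w.1.embedding Ha.det).re) ↔ (0 < (w.1.embedding (Hb 0 0)).re)) ↔ (0 < ((Hb.map F * y₂).map (UnitaryGroup.evalC L w)).det.re)) := by
    intro w
    rw [pos_iff_mul_pos_iff (hA0 w) (hB0 w), hABde w, mul_pos_iff_of_pos_right (hN w), mul_pos_iff_pos_iff_pos (hd0 w) (he0 w)]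
  refine ⟨fun w => (Finset.univ.filter fun i => 0 < (herm hb₁ ⟨w, hallc w⟩).eigenvalues i).card, ξ, hξσ, hξ0, fun w => ?_, fun τ => ?_,
    fun τ h₁ => ?_, y₁, y₂, hG'P, fun w h => rfl, fun w h₁ => ?_⟩
  · -- `p w ≤ 2`
    exact (Finset.card_filter_le _ _).trans (by rw [Finset.card_univ, Fintype.card_fin])
  · -- PARITY at `τ`
    beta_reduce
    let w : {w : InfinitePlace L // w.IsComplex} := ⟨InfinitePlace.mk τ, hallc _⟩
    obtain ⟨r, hr, hr0, hiff⟩ := hξw w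
    have hτξ : τ ξ = r := by
      rcases InfinitePlace.embedding_mk_eq τ with h | h
      · rw [← hr]; exact (congrFun (congrArg DFunLike.coe h) ξ).symm
      · have h' := congrFun (congrArg DFunLike.coe h) ξ
        rw [ComplexEmbedding.conjugate_coe_eq] at h'
        have : starRingEnd ℂ (τ ξ) = r := h'.symm.trans hr |>.symm ▸ (h'.symm.trans hr)
        rw [← Complex.conj_conj (τ ξ), this, Complex.conj_ofReal]
    have e := card_pos_add_card_neg_eigenvalues_eq_card (herm hb₁ w) (by rw [hAre w]; exact_mod_cast hA0 w)
    rw [Fintype.card_fin] at e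
    have h1 : (0 < (τ (ξ * Ha.det)).re) ↔ ((0 < r) ↔ (0 < (w.1.embedding Ha.det).re)) := by
      rw [map_mul, hτξ, Complex.re_ofReal_mul, hre τ Ha.det]
      exact mul_pos_iff_pos_iff_pos hr0 (hd0 w)
    have h2 := re_det_pos_iff_even_card_neg_eigenvalues (herm hb₁ w) (by rw [hAre w]; exact_mod_cast hA0 w)
    have h3 : (Finset.univ.filter fun i => (herm hb₁ w).eigenvalues i < 0).card =
        2 - (Finset.univ.filter fun i => 0 < (herm hb₁ w).eigenvalues i).card := by omega
    rw [h3] at h2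
    rw [h1, hiff, ← h2, hplane w]
    exact iff_iff_iff_shuffle _ _ _
  · -- TOTAL at `τ`
    beta_reduce
    let w : {w : InfinitePlace L // w.IsComplex} := ⟨InfinitePlace.mk τ, hallc _⟩
    have hHw : (H.map w.1.embedding).IsHermitian := by rw [← hFmw w H, ← hHv]; exact herm hσvHv w
    have hτw : (Finset.univ.filter fun i => 0 < h₁.eigenvalues i).card = (Finset.univ.filter fun i => 0 < hHw.eigenvalues i).card := by
      rcases InfinitePlace.embedding_mk_eq τ with h | h
      · have h' : w.1.embedding = τ := h
        exact card_pos_eigenvalues_congr₃ (by rw [h']) h₁ hHw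
      · have h' : w.1.embedding = ComplexEmbedding.conjugate τ := h
        have h₂ : (H.map (ComplexEmbedding.conjugate τ)).IsHermitian := by rw [← h']; exact hHw
        rw [← card_pos_eigenvalues_map_conjugate₃ h₁ h₂]
        exact card_pos_eigenvalues_congr₃ (by rw [h']) h₂ hHw
    rw [hτw, hre τ (ξ⁻¹ * Hb 0 0)]
    have hG'w := herm hG' w
    have hgw : IsUnit (((g : Matrix (Fin 3) (Fin 3) (mixedEmbedding.mixedSpace L))).map (UnitaryGroup.evalC L w)).det := by
      rw [← RingHom.mapMatrix_apply, ← RingHom.map_det]; exact hgd.map _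
    have e₁ : (Finset.univ.filter fun i => 0 < hHw.eigenvalues i).card = (Finset.univ.filter fun i => 0 < hG'w.eigenvalues i).card :=
      QuadraticForms.Landherr.card_pos_eigenvalues_eq_of_congr hHw hG'w hgw (by
        rw [hG'def, twistGram_conjMixed_map_evalC _ L _ hc1 hfix, hHv, hFmw w H])
    have hfinw : (finSum 2 1 ((Ha.map F * y₁).map (UnitaryGroup.evalC L w)) ((Hb.map F * y₂).map (UnitaryGroup.evalC L w))).IsHermitian := by
      rw [← finSum_map, ← hG'P]; exact herm (conjTranspose_twistGram σv G' hσσv hG' _) w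
    have hPw : IsUnit ((Pv.val).map (UnitaryGroup.evalC L w)).det := by
      have h := hPu.map (UnitaryGroup.evalC L w)
      rw [RingHom.map_det, RingHom.mapMatrix_apply] at h
      exact h
    have hcong : ((Pv.val).map (UnitaryGroup.evalC L w))ᴴ * G'.map (UnitaryGroup.evalC L w) * (Pv.val).map (UnitaryGroup.evalC L w) =
        finSum 2 1 ((Ha.map F * y₁).map (UnitaryGroup.evalC L w)) ((Hb.map F * y₂).map (UnitaryGroup.evalC L w)) := by
      rw [← twistGram_conjMixed_map_evalC _ L _ hc1 hfix, hG'P, finSum_map]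
    have e₂ : (Finset.univ.filter fun i => 0 < hG'w.eigenvalues i).card = (Finset.univ.filter fun i => 0 < hfinw.eigenvalues i).card :=
      QuadraticForms.Landherr.card_pos_eigenvalues_eq_of_congr (g := (Pv.val).map (UnitaryGroup.evalC L w)) hG'w hfinw hPw hcong
    have e₃ := card_eigenvalues_finSum_eq_add (herm hb₁ w) (herm hb₂ w) hfinw (fun x => 0 < x)
    rw [e₁, e₂, e₃, card_pos_eigenvalues_fin_one (herm hb₂ w), ← Matrix.det_fin_one ((Hb.map F * y₂).map (UnitaryGroup.evalC L w))]
    congr 1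
    by_cases hq : 0 < ((Hb.map F * y₂).map (UnitaryGroup.evalC L w)).det.re
    · rw [if_pos hq, if_pos ((hline w).mp hq)]
    · rw [if_neg hq, if_neg (fun h => hq ((hline w).mpr h))]
  · -- the line block
    rw [card_pos_eigenvalues_fin_one h₁, ← Matrix.det_fin_one ((Hb.map F * y₂).map (UnitaryGroup.evalC L w))]
    by_cases hq : 0 < ((Hb.map F * y₂).map (UnitaryGroup.evalC L w)).det.re
    · rw [if_pos hq, if_pos ((hline w).mp hq)]
    · rw [if_neg hq, if_neg (fun h => hq ((hline w).mpr h))]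

end ArchData

end Literature.NumberTheory.Rogawski1990

end
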